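import Summits.AtomisticToContinuum.HydrodynamicLimit.Theses.SpeedCapSurgery
import Literature.MathematicalPhysics.KineticTheory.HardSphereEuler
import Literature.Barriers.AtomisticToContinuum.HighMomentumCutoff
import HarnessLib

/-!
# Dock of the (i)-tails stub of the crux `AprioriBounds` to `SpeedCapSurgery.GaussianVelocityTails`
(line `Sketch`, crux `StiffCollisionalRelaxation.AprioriBounds`, stmt-AtomisticToContinuum-14827)

Helper file (`--supports stmt-AtomisticToContinuum-14827`), stub
`velocityTails_of_gaussianVelocityTails` (reshape r7, cycle 5).

Reshape r7 of the crux splits its component (i) into an EXPECTED Gaussian velocity moment along the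
flow (`stub_velocityTails`, the hard-sphere transcription of Nachtergaele–Yau's Assumption II.1) and a
fixed-time law of large numbers.  The tails statement carries the crux's prefix
"profiles → `∃ σ₀ ∃ η₁ ∀ σ < σ₀` → classical hs-Euler solution on `[0, T)` → flow family with the
`t = 0` LLN → `0 < t < T` with the chamber `2ρσ³ < η₁` on `[0, t]`" and concludes
`∃ c > 0, C < ⊤, N₀ ∀ N ≥ N₀ ∀ s ∈ [0, t]`, `∫⁻ expVelocityMoment c (Φ_N(s) z) dλ^N ≤ C`.

* `stub_velocityTails_of_gaussianVelocityTails`: the existing route item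
  `SpeedCapSurgery.GaussianVelocityTails` (stmt-AtomisticToContinuum-9633: for all profiles
  `∃ σ₀ ∀ σ < σ₀ ∀ T > 0 ∀ Φ ∃ c, C < ⊤, N₀ ∀ N ≥ N₀ ∀ t ∈ [0, T]`, the same bound) implies the
  stub: take its `σ₀`, `η₁ := 1`, and apply it at horizon `T := t` (`0 < t`) to the flow family `Φ`;
  the Euler solution, the `t = 0` LLN and the chamber are not used.
* `velocityTails_of_highMomentumCutoff`: the same conclusion from the literature hypothesis
  `Literature.Barriers.AtomisticToContinuum.HighMomentumCutoff σ` for all small `σ` (its body has no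
  threshold `N₀`, so `N₀ := 0`).

No new definitions, no named facts; axioms `propext`, `Classical.choice`, `Quot.sound`.
-/

noncomputable section

open MeasureTheory Filter Set Topology
open scoped ENNReal

namespace Summit.AtomisticToContinuum.HydrodynamicLimit.Theorems.AdiabatCeiling

open Literature.MathematicalPhysics.KineticTheory Literature.Analysis.FluidPDE

/-- DOCK of the (i)-tails stub (reshape r7 of the crux `AprioriBounds`): the route item
`SpeedCapSurgery.GaussianVelocityTails` (stmt-AtomisticToContinuum-9633) implies `stub_velocityTails` —
apply it at horizon `T := t`; the Euler solution, the `t = 0` LLN and the chamber are unused; `η₁ := 1`. -/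
theorem stub_velocityTails_of_gaussianVelocityTails :
    Summit.AtomisticToContinuum.HydrodynamicLimit.Theses.SpeedCapSurgery.GaussianVelocityTails →
    ∀ (a₀ θ₀ : T3 → ℝ) (u₀ : T3 → V3), Continuous a₀ → Continuous θ₀ → Continuous u₀ →
      (∀ x, 0 < a₀ x) → (∀ x, 0 < θ₀ x) →
      ∃ σ₀ : ℝ, 0 < σ₀ ∧ ∃ η₁ : ℝ, 0 < η₁ ∧ ∀ σ : ℝ, 0 < σ → σ < σ₀ →
        ∀ (T : ℝ) (ρ θ : ℝ → T3 → ℝ) (u : ℝ → T3 → V3), IsHardSphereEulerSolution σ T ρ u θ →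
        ∀ Φ : (N : ℕ) → HardSphereFlow (Torus.geometry (Fin 3)) (hsDiameter σ N) (N + 1),
          TendstoHydroFieldsAt (fun N => localGibbsLaw σ a₀ u₀ θ₀ N (Φ N)) Φ ρ u θ 0 →
          ∀ t : ℝ, 0 < t → t < T → (∀ s ∈ Icc 0 t, ∀ x, 2 * ρ s x * σ ^ 3 < η₁) →
            ∃ c : ℝ, 0 < c ∧ ∃ C : ℝ≥0∞, C < ⊤ ∧ ∃ N₀ : ℕ, ∀ N : ℕ, N₀ ≤ N → ∀ s ∈ Icc 0 t,
              ∫⁻ z, Literature.Barriers.AtomisticToContinuum.expVelocityMoment c ((Φ N).flow s z)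
                ∂(localGibbsLaw σ a₀ u₀ θ₀ N (Φ N)) ≤ C := by
  intro h a₀ θ₀ u₀ ha hθ hu ha0 hθ0
  obtain ⟨σ₀, hσ₀, hb⟩ := h a₀ θ₀ u₀ ha hθ hu ha0 hθ0
  refine ⟨σ₀, hσ₀, 1, one_pos, fun σ hσ hσlt T _ρ _θ _u _hsol Φ _hLLN t ht _htT _hdil => ?_⟩
  exact hb σ hσ hσlt t ht Φ

/-- The same conclusion from the literature hypothesis `HighMomentumCutoff σ` for all small `σ`
(Nachtergaele–Yau's Assumption II.1 transcribed to hard spheres; its body has no threshold, so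
`N₀ := 0`); `η₁ := 1`, horizon `T := t`, the Euler solution, the LLN and the chamber unused. -/
theorem velocityTails_of_highMomentumCutoff :
    (∃ σ₀ : ℝ, 0 < σ₀ ∧ ∀ σ : ℝ, 0 < σ → σ < σ₀ →
      Literature.Barriers.AtomisticToContinuum.HighMomentumCutoff σ) →
    ∀ (a₀ θ₀ : T3 → ℝ) (u₀ : T3 → V3), Continuous a₀ → Continuous θ₀ → Continuous u₀ →
      (∀ x, 0 < a₀ x) → (∀ x, 0 < θ₀ x) →
      ∃ σ₀ : ℝ, 0 < σ₀ ∧ ∃ η₁ : ℝ, 0 < η₁ ∧ ∀ σ : ℝ, 0 < σ → σ < σ₀ →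
        ∀ (T : ℝ) (ρ θ : ℝ → T3 → ℝ) (u : ℝ → T3 → V3), IsHardSphereEulerSolution σ T ρ u θ →
        ∀ Φ : (N : ℕ) → HardSphereFlow (Torus.geometry (Fin 3)) (hsDiameter σ N) (N + 1),
          TendstoHydroFieldsAt (fun N => localGibbsLaw σ a₀ u₀ θ₀ N (Φ N)) Φ ρ u θ 0 →
          ∀ t : ℝ, 0 < t → t < T → (∀ s ∈ Icc 0 t, ∀ x, 2 * ρ s x * σ ^ 3 < η₁) →
            ∃ c : ℝ, 0 < c ∧ ∃ C : ℝ≥0∞, C < ⊤ ∧ ∃ N₀ : ℕ, ∀ N : ℕ, N₀ ≤ N → ∀ s ∈ Icc 0 t,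
              ∫⁻ z, Literature.Barriers.AtomisticToContinuum.expVelocityMoment c ((Φ N).flow s z)
                ∂(localGibbsLaw σ a₀ u₀ θ₀ N (Φ N)) ≤ C := by
  rintro ⟨σ₀, hσ₀, h⟩ a₀ θ₀ u₀ ha hθ hu ha0 hθ0
  refine ⟨σ₀, hσ₀, 1, one_pos, fun σ hσ hσlt T _ρ _θ _u _hsol Φ _hLLN t ht _htT _hdil => ?_⟩
  obtain ⟨c, hc, C, hC, hb⟩ := h σ hσ hσlt a₀ θ₀ u₀ ha hθ hu ha0 hθ0 t ht Φ
  exact ⟨c, hc, C, hC, 0, fun N _ s hs => hb N s hs⟩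

end Summit.AtomisticToContinuum.HydrodynamicLimit.Theorems.AdiabatCeiling

end
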